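import Summits.AtomisticToContinuum.HydrodynamicLimit.Theses.InformationPercolationEngine
import Literature.MathematicalPhysics.KineticTheory.TaggedSphereDiffusionCorrector
import Literature.MeasureTheory.Lebesgue.SierpinskiSphereSet

/-!
# Refutation of `InformationPercolationEngine.SpectralContraction` (stmt-AtomisticToContinuum-13479) [refuted-misstated]

The crux quantifies over ALL `f : V3 → ℝ` — no measurability — and its hypotheses and conclusion
are iterated BOCHNER integrals, whose value on a non-a.e.-measurable integrand is the junk `0`.
Witness: `f = -1` on `A`, `+1` off `A`, where `A ⊆ ℝ³` is the Sierpiński-type set of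
`Literature.MeasureTheory.Lebesgue.exists_sierpinskiSphereSet` (not Lebesgue-null-measurable, finite
on every round sphere). Then `f² = 1`, so the integrability hypothesis is that of `ν M` (the tree's
`integrable_collisionFrequency_mul_maxwellianBeta` at `β = 1`, `ν = a₁ =
TaggedSphereDiffusion.collisionFrequency 1` by `maxwellianBeta_one`); the mean-zero hypothesis
`∫ f ν M = 0` holds BY JUNK (`f · νM` is not a.e.-strongly measurable, `integral_undef`); and on every
collision sphere `{v - ⟪v - w, ω⟫ω : ω ∈ S²}` (the sphere with diameter `[v, w]`, Thales) the set `A`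
is finite, its preimage in `ω` (two directions per point off the pole, `coe_eq_of_collide`) is
`σ`-null (`sphereMeasure_singleton`: the cone over a point lies in a line, `Measure.addHaar_submodule`),
so each inner collision integral of `f` equals that of `1` and `K f = ν⁻¹ · ν = 1` identically
(`ν > 0`, `exists_collisionFrequency_lowerBound`). The conclusion then reads `Z ≤ c Z` with
`Z = ∫ ν M > 0` and `c < 1/2`: false.
REPAIR (misstated; the witness is non-measurable and misses it): C′ = the same statement with
`Measurable f →` inserted after `∀ f : Literature.MathematicalPhysics.KineticTheory.V3 → ℝ,` (equivalently
quantify over `Lp ℝ 2 (energyMeasure 1)` and use the tree's `gainOp`). C′ is numerically TRUE with margin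
(`λ₂(K)² ≈ 0.22 < 1/2`, K positive semidefinite; refuter evidence on the item) and is the provers' target.
refuter-cdisprove-stmt-AtomisticToContinuum-13479-0.  The refuted decl was then replaced in the route by
`SpectralContractionR` (measurable `f`); it is re-created privately below, so the theorem's (append-only)
statement is unchanged and nothing depends on the retired route name.
-/

noncomputable section

open MeasureTheory Metric Real Set Filter Topology
open scoped InnerProductSpace ENNReal Pointwise

/-- PRIVATE re-creation (route namespace stays free; a refuted statement, NOT a cited fact) of the
route decl `…Theses.InformationPercolationEngine.SpectralContraction`, stmt-AtomisticToContinuum-13479,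
which the planner REPLACED by the measurable-`f` repair `SpectralContractionR` (rev 3) after the
refutation below, so the name left `Theses/InformationPercolationEngine.lean` (full-build breakage
2026-08-16, `Unknown identifier`): the item's recorded signature verbatim, so that the append-only
refuting theorem keeps elaborating. -/
private def Summit.AtomisticToContinuum.HydrodynamicLimit.Theses.InformationPercolationEngine.SpectralContraction :
    Prop :=
  ∃ c : ℝ, c < 1 / 2 ∧
    let M : Literature.MathematicalPhysics.KineticTheory.V3 → ℝ := Literature.Analysis.FluidPDE.globalMaxwellian;
    let S : MeasureTheory.Measure (Metric.sphere (0 : Literature.MathematicalPhysics.KineticTheory.V3) 1) :=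
      Literature.MathematicalPhysics.KineticTheory.sphereMeasure;
    let ν : Literature.MathematicalPhysics.KineticTheory.V3 → ℝ := fun v =>
      ∫ w, ∫ ω, Literature.MathematicalPhysics.KineticTheory.hardSphereKernel (v, w) ω * M w ∂S;
    let K : (Literature.MathematicalPhysics.KineticTheory.V3 → ℝ) →
        Literature.MathematicalPhysics.KineticTheory.V3 → ℝ := fun f v =>
      (ν v)⁻¹ * ∫ w, ∫ ω, Literature.MathematicalPhysics.KineticTheory.hardSphereKernel (v, w) ω * M w *
        f (Literature.MathematicalPhysics.KineticTheory.collide ω (v, w)).1 ∂S;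
    ∀ f : Literature.MathematicalPhysics.KineticTheory.V3 → ℝ,
      MeasureTheory.Integrable (fun v => f v ^ 2 * (ν v * M v)) → ∫ v, f v * (ν v * M v) = 0 →
      ∫ v, K f v ^ 2 * (ν v * M v) ≤ c * ∫ v, f v ^ 2 * (ν v * M v)

namespace Summit.AtomisticToContinuum.HydrodynamicLimit.Theorems

open Literature.MathematicalPhysics.KineticTheory
open Literature.Analysis.FunctionSpaces (maxwellianBeta maxwellianBeta_one maxwellianBeta_pos)
open Literature.Analysis.FluidPDE (globalMaxwellian globalMaxwellian_pos)

/-- `ν = a₁`: the crux's collision frequency is the tree's `collisionFrequency` at `β = 1`. [folklore] -/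
private theorem SpectralContraction.nu_eq (v : V3) :
    ∫ w, ∫ ω, hardSphereKernel (v, w) ω * globalMaxwellian w ∂sphereMeasure =
      TaggedSphereDiffusion.collisionFrequency (d := Fin 3) 1 v := by
  simp only [TaggedSphereDiffusion.collisionFrequency, maxwellianBeta_one]

/-- `2 ≤ 3`. [folklore] -/
private theorem SpectralContraction.two_le_card : 2 ≤ Fintype.card (Fin 3) := by simp

/-- `ν > 0`. [folklore] -/
private theorem SpectralContraction.nu_pos (v : V3) :
    0 < ∫ w, ∫ ω, hardSphereKernel (v, w) ω * globalMaxwellian w ∂sphereMeasure := by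
  obtain ⟨a₀, ha₀, c, _, hlow⟩ :=
    exists_collisionFrequency_lowerBound (d := Fin 3) SpectralContraction.two_le_card one_pos
  rw [SpectralContraction.nu_eq]
  exact ha₀.trans_le (hlow v).1

/-- `ν M` is integrable. [folklore] -/
private theorem SpectralContraction.integrable_nuM :
    Integrable (fun v : V3 =>
      (∫ w, ∫ ω, hardSphereKernel (v, w) ω * globalMaxwellian w ∂sphereMeasure) * globalMaxwellian v) := by
  have h := integrable_collisionFrequency_mul_maxwellianBeta (d := Fin 3) (β := 1) one_pos
  rw [maxwellianBeta_one] at h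
  refine h.congr (Eventually.of_forall fun v => ?_)
  simp only [SpectralContraction.nu_eq]

/-- `ν M` is measurable. [folklore] -/
private theorem SpectralContraction.measurable_nuM :
    Measurable (fun v : V3 =>
      (∫ w, ∫ ω, hardSphereKernel (v, w) ω * globalMaxwellian w ∂sphereMeasure) * globalMaxwellian v) := by
  have h1 : Continuous (TaggedSphereDiffusion.collisionFrequency (d := Fin 3) 1) :=
    continuous_collisionFrequency one_pos
  have h2 : Continuous (globalMaxwellian : V3 → ℝ) := by
    unfold Literature.Analysis.FluidPDE.globalMaxwellian; fun_prop
  have : (fun v : V3 =>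
      (∫ w, ∫ ω, hardSphereKernel (v, w) ω * globalMaxwellian w ∂sphereMeasure) * globalMaxwellian v) =
      fun v => TaggedSphereDiffusion.collisionFrequency (d := Fin 3) 1 v * globalMaxwellian v := by
    funext v; rw [SpectralContraction.nu_eq]
  rw [this]
  exact (h1.mul h2).measurable

/-- `Z = ∫ ν M > 0`. [folklore] -/
private theorem SpectralContraction.integral_nuM_pos :
    0 < ∫ v : V3,
      (∫ w, ∫ ω, hardSphereKernel (v, w) ω * globalMaxwellian w ∂sphereMeasure) * globalMaxwellian v := by
  have hnn : 0 ≤ fun v : V3 =>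
      (∫ w, ∫ ω, hardSphereKernel (v, w) ω * globalMaxwellian w ∂sphereMeasure) * globalMaxwellian v :=
    fun v => mul_nonneg (SpectralContraction.nu_pos v).le (globalMaxwellian_pos v).le
  rw [integral_pos_iff_support_of_nonneg hnn SpectralContraction.integrable_nuM]
  have hsupp : Function.support (fun v : V3 =>
      (∫ w, ∫ ω, hardSphereKernel (v, w) ω * globalMaxwellian w ∂sphereMeasure) * globalMaxwellian v) =
      Set.univ := by
    ext v
    simp only [Function.mem_support, Set.mem_univ, iff_true]
    exact (mul_pos (SpectralContraction.nu_pos v) (globalMaxwellian_pos v)).ne'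
  rw [hsupp]
  simp

/-- Singletons of the unit sphere are `σ`-null (the cone over a point lies in a line, a proper
subspace, Lebesgue-null; `Measure.toSphere_apply'`). [folklore] -/
private theorem SpectralContraction.sphereMeasure_singleton (ω₀ : Metric.sphere (0 : V3) 1) :
    (sphereMeasure : Measure (Metric.sphere (0 : V3) 1)) {ω₀} = 0 := by
  unfold sphereMeasure
  rw [Measure.toSphere_apply' _ (measurableSet_singleton ω₀)]
  set S : Submodule ℝ V3 := Submodule.span ℝ {(ω₀ : V3)} with hS
  have hω0 : (ω₀ : V3) ≠ 0 := ne_zero_of_mem_unit_sphere ω₀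
  have hStop : S ≠ ⊤ := by
    intro htop
    have h1 : Module.finrank ℝ S = 1 := by rw [hS]; exact finrank_span_singleton hω0
    have h2 : Module.finrank ℝ S = Module.finrank ℝ V3 := by rw [htop, finrank_top]
    rw [h1, finrank_euclideanSpace_fin] at h2
    omega
  have hcone : Set.Ioo (0 : ℝ) 1 • (((↑) : Metric.sphere (0 : V3) 1 → V3) '' {ω₀}) ⊆ (S : Set V3) := by
    rintro _ ⟨r, -, _, ⟨ω, hω, rfl⟩, rfl⟩
    rw [Set.mem_singleton_iff] at hω
    subst hω
    show r • (ω : V3) ∈ S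
    rw [hS]
    exact Submodule.smul_mem _ _ (Submodule.subset_span rfl)
  rw [measure_mono_null hcone (Measure.addHaar_submodule _ S hStop), mul_zero]

/-- Collision geometry (Thales): `v' = v - ⟪v - w, ω⟫ ω` lies on the sphere with diameter
`[v, w]`. [folklore] -/
private theorem SpectralContraction.collide_fst_mem_sphere (v w : V3) (ω : Metric.sphere (0 : V3) 1) :
    (collide ω (v, w)).1 ∈ Metric.sphere ((1 / 2 : ℝ) • (v + w)) (‖v - w‖ / 2) := by
  have hω1 : ‖(ω : V3)‖ = 1 := norm_eq_of_mem_sphere ω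
  rw [Metric.mem_sphere, dist_eq_norm]
  have hp : (collide ω (v, w)).1 - (1 / 2 : ℝ) • (v + w) =
      (1 / 2 : ℝ) • (v - w) - ⟪v - w, (ω : V3)⟫_ℝ • (ω : V3) := by
    simp only [collide]
    module
  rw [hp]
  have hsq : ‖(1 / 2 : ℝ) • (v - w) - ⟪v - w, (ω : V3)⟫_ℝ • (ω : V3)‖ ^ 2 = (‖v - w‖ / 2) ^ 2 := by
    rw [norm_sub_sq_real, real_inner_smul_left, real_inner_smul_right, norm_smul, norm_smul, hω1,
      Real.norm_eq_abs, Real.norm_eq_abs, abs_of_pos (by norm_num : (0 : ℝ) < 1 / 2), mul_one,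
      mul_pow, sq_abs]
    ring
  exact (pow_left_inj₀ (norm_nonneg _) (by positivity) two_ne_zero).1 hsq

/-- For `⟪v - w, ω⟫ > 0` the impact direction is recovered from `v'`:
`ω = (v - v')/‖v - v'‖`. [folklore] -/
private theorem SpectralContraction.coe_eq_of_collide {v w : V3} {ω : Metric.sphere (0 : V3) 1}
    (ht : 0 < ⟪v - w, (ω : V3)⟫_ℝ) :
    (ω : V3) = ‖v - (collide ω (v, w)).1‖⁻¹ • (v - (collide ω (v, w)).1) := by
  have hp : v - (collide ω (v, w)).1 = ⟪v - w, (ω : V3)⟫_ℝ • (ω : V3) := by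
    simp only [collide]
    exact sub_sub_cancel _ _
  rw [hp, norm_smul, norm_eq_of_mem_sphere ω, mul_one, Real.norm_eq_abs, abs_of_pos ht, smul_smul,
    inv_mul_cancel₀ ht.ne', one_smul]

/-- The kernel vanishes unless `⟪v - w, ω⟫ > 0`. [folklore] -/
private theorem SpectralContraction.kernel_eq_zero_of_not_pos {v w : V3} {ω : Metric.sphere (0 : V3) 1}
    (h : ¬ 0 < ⟪v - w, (ω : V3)⟫_ℝ) : hardSphereKernel (v, w) ω = 0 := by
  unfold hardSphereKernel
  exact max_eq_right (not_lt.1 h)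

/-- On each collision sphere a sphere-finite set is invisible: if `f = 1` off `A` and `A` meets every
round sphere countably, the inner collision integral of `f` equals the `f ≡ 1` one. [folklore] -/
private theorem SpectralContraction.inner_integral_eq {A : Set V3}
    (hS : ∀ (c : V3) (ρ : ℝ), (A ∩ Metric.sphere c ρ).Countable) {f : V3 → ℝ}
    (hf : ∀ x, x ∉ A → f x = 1) (v w : V3) :
    ∫ ω, hardSphereKernel (v, w) ω * globalMaxwellian w * f (collide ω (v, w)).1 ∂sphereMeasure =
      ∫ ω, hardSphereKernel (v, w) ω * globalMaxwellian w ∂sphereMeasure := by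
  set D : Set (Metric.sphere (0 : V3) 1) :=
    {ω | 0 < ⟪v - w, (ω : V3)⟫_ℝ ∧ (collide ω (v, w)).1 ∈ A} with hD
  set C : Set V3 := A ∩ Metric.sphere ((1 / 2 : ℝ) • (v + w)) (‖v - w‖ / 2) with hC
  have hCc : C.Countable := hS _ _
  let F : V3 → Set (Metric.sphere (0 : V3) 1) :=
    fun p => {ω | (ω : V3) = ‖v - p‖⁻¹ • (v - p)}
  have hsub : D ⊆ ⋃ p ∈ C, F p := by
    intro ω hω
    obtain ⟨ht, hA⟩ := hω
    refine Set.mem_iUnion₂.2 ⟨(collide ω (v, w)).1,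
      ⟨hA, SpectralContraction.collide_fst_mem_sphere v w ω⟩, ?_⟩
    exact SpectralContraction.coe_eq_of_collide ht
  have hF : ∀ p, (sphereMeasure : Measure (Metric.sphere (0 : V3) 1)) (F p) = 0 := by
    intro p
    rcases (F p).eq_empty_or_nonempty with h | ⟨ω₀, hω₀⟩
    · rw [h, measure_empty]
    · have : F p = {ω₀} := by
        refine Set.eq_singleton_iff_unique_mem.2 ⟨hω₀, fun ω hω => Subtype.ext ?_⟩
        exact (show (ω : V3) = _ from hω).trans (show (ω₀ : V3) = _ from hω₀).symm
      rw [this]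
      exact SpectralContraction.sphereMeasure_singleton ω₀
  have hnull : (sphereMeasure : Measure (Metric.sphere (0 : V3) 1)) D = 0 :=
    measure_mono_null hsub ((measure_biUnion_null_iff hCc).2 fun p _ => hF p)
  have hae : ∀ᵐ ω ∂(sphereMeasure : Measure (Metric.sphere (0 : V3) 1)), ω ∉ D := by
    rw [ae_iff]
    simpa only [not_not, Set.setOf_mem_eq] using hnull
  refine integral_congr_ae ?_
  filter_upwards [hae] with ω hω
  by_cases ht : 0 < ⟪v - w, (ω : V3)⟫_ℝ
  · have hA : (collide ω (v, w)).1 ∉ A := fun h => hω ⟨ht, h⟩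
    rw [hf _ hA, mul_one]
  · rw [SpectralContraction.kernel_eq_zero_of_not_pos ht]; simp

/-- Hence `K f = 1` identically for such `f`. [folklore] -/
private theorem SpectralContraction.K_eq_one {A : Set V3}
    (hS : ∀ (c : V3) (ρ : ℝ), (A ∩ Metric.sphere c ρ).Countable) {f : V3 → ℝ}
    (hf : ∀ x, x ∉ A → f x = 1) (v : V3) :
    (∫ w, ∫ ω, hardSphereKernel (v, w) ω * globalMaxwellian w ∂sphereMeasure)⁻¹ *
        ∫ w, ∫ ω, hardSphereKernel (v, w) ω * globalMaxwellian w * f (collide ω (v, w)).1 ∂sphereMeasure =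
      1 := by
  have hfun : (fun w => ∫ ω, hardSphereKernel (v, w) ω * globalMaxwellian w *
      f (collide ω (v, w)).1 ∂sphereMeasure) =
      fun w => ∫ ω, hardSphereKernel (v, w) ω * globalMaxwellian w ∂sphereMeasure :=
    funext (SpectralContraction.inner_integral_eq hS hf v)
  rw [hfun]
  exact inv_mul_cancel₀ (SpectralContraction.nu_pos v).ne'

/-- Bochner junk: if `f ⁻¹' {-1}` is not null-measurable, the "mean" `∫ f dπ` is `0` by definition,
so the mean-zero hypothesis of the crux holds for free. [folklore] -/
private theorem SpectralContraction.integral_eq_zero_of_not_nullMeasurable {f : V3 → ℝ}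
    (hA : ¬ NullMeasurableSet (f ⁻¹' {(-1 : ℝ)}) volume) :
    ∫ v, f v * ((∫ w, ∫ ω, hardSphereKernel (v, w) ω * globalMaxwellian w ∂sphereMeasure) *
      globalMaxwellian v) = 0 := by
  apply integral_undef
  intro hI
  apply hA
  have hprod := hI.aestronglyMeasurable.aemeasurable
  have hf : AEMeasurable f volume := by
    refine (hprod.div SpectralContraction.measurable_nuM.aemeasurable).congr
      (ae_of_all _ fun v => ?_)
    have hne : (∫ w, ∫ ω, hardSphereKernel (v, w) ω * globalMaxwellian w ∂sphereMeasure) *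
        globalMaxwellian v ≠ 0 :=
      (mul_pos (SpectralContraction.nu_pos v) (globalMaxwellian_pos v)).ne'
    simp only [Pi.div_apply]
    exact mul_div_cancel_right₀ _ hne
  exact hf.nullMeasurable (measurableSet_singleton _)

/-- Refutes `InformationPercolationEngine.SpectralContraction` [refuted-misstated]: the ±1 sign pattern
`f` of the Sierpiński sphere set `A` (`exists_sierpinskiSphereSet`) satisfies the integrability hypothesis
(`f² = 1`), the mean-zero hypothesis by Bochner junk (`A` not null-measurable), and has `K f = 1`
(`A` finite on every collision sphere), so the conclusion reads `Z ≤ c Z`, `Z = ∫ ν M > 0`, `c < 1/2`.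
Repair: insert `Measurable f →` (module docstring). [folklore] -/
theorem InformationPercolationEngineSpectralContraction_refuted :
    ¬ Summit.AtomisticToContinuum.HydrodynamicLimit.Theses.InformationPercolationEngine.SpectralContraction := by
  classical
  obtain ⟨A, hA, hfin⟩ := Literature.MeasureTheory.Lebesgue.exists_sierpinskiSphereSet
  have hS : ∀ (c : V3) (ρ : ℝ), (A ∩ Metric.sphere c ρ).Countable := fun c ρ => (hfin c ρ).countable
  set f : V3 → ℝ := fun x => if x ∈ A then -1 else 1 with hfdef
  have hf1 : ∀ x, x ∉ A → f x = 1 := fun x hx => by simp only [hfdef, if_neg hx]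
  have hfsq : ∀ x, f x ^ 2 = 1 := fun x => by
    simp only [hfdef]; split_ifs <;> norm_num
  have hpre : f ⁻¹' {(-1 : ℝ)} = A := by
    ext x
    simp only [Set.mem_preimage, Set.mem_singleton_iff, hfdef]
    split_ifs with h
    · simp [h]
    · simp only [h, iff_false]; norm_num
  rintro ⟨c, hc, h⟩
  have hint : Integrable (fun v : V3 => f v ^ 2 *
      ((∫ w, ∫ ω, hardSphereKernel (v, w) ω * globalMaxwellian w ∂sphereMeasure) *
        globalMaxwellian v)) := by
    refine SpectralContraction.integrable_nuM.congr (Eventually.of_forall fun v => ?_)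
    simp only [hfsq, one_mul]
  have hmean : ∫ v, f v * ((∫ w, ∫ ω, hardSphereKernel (v, w) ω * globalMaxwellian w ∂sphereMeasure) *
      globalMaxwellian v) = 0 :=
    SpectralContraction.integral_eq_zero_of_not_nullMeasurable (hpre.symm ▸ hA)
  have h1 := h f hint hmean
  simp only [SpectralContraction.K_eq_one hS hf1, hfsq, one_pow, one_mul] at h1
  have hZ := SpectralContraction.integral_nuM_pos
  nlinarith

end Summit.AtomisticToContinuum.HydrodynamicLimit.Theorems

end
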